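import Summits.QuantumFields.YangMills.Theorems.BalabanUVNodesN15CurvedGluingCubeSpeciesEntries
import HarnessLib

/-!
# Route «BalabanUVNodes» (cluster K4 «SpineRates»), Track-A DAG node N15 = NE2, BACKGROUND LAYER — THE DRESSED CUBE PROPAGATOR, `hloc` EDITION: for ANY flat cube propagator `G₀` with the
# per-cube locality `M_χ∘Δ∘G₀ = M_χ` (dag-n15-c FILE 45's `hloc`, e.g. dag-n15-a's `M_χ∘neumannCubeG`) the dressed pair `X = pr₀(1 − Ĝ₀V̂(c, a))⁻¹Ĝ₀` with the ORIGINAL species keeps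
# `hloc` at the live background, `M_χ∘(Δ − V(c, a))∘X = M_χ`, and has output-localized entries 0∕1 under the PRINT-COMPATIBLE smallness `β(r_c + r_a)(1 + |J ⊕ J|)c_r < 1` — no cut-off
# quotient, no boundary letter

Cell `pub-ymgap`, seat `pub-ymgap-dag-n15-w3` (WIDTH SEAT 3∕3 on node N15, director-ym №197 ∕ HUMAN RULING D-0149; plan `W-SEAT-START-LIST.md` §n15 item 3 — twentieth piece: the device of
files 16–19 in the shape dag-n15-c's (Γ14) knit consumes (FILE 45 `hloc` + `hG`∕`hD` rows; his l.28259 checklist at a live `U`)).  `bears_on: R4∕N15 · K3⁷ SpineGivenEndpointR13SepCoPH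
(stmt-QuantumFields-20544)`.  Filed `--kind proof --supports stmt-QuantumFields-20544 --as helper` — COUNT-NEUTRAL.  Theorems only; 0 `sorry`.  Imports BY NAME file 17 `…N15CurvedGluingCubeSpeciesEntries`
(file 16 `fgrad_comp_dressed`∕`bgrad_comp_dressed`, file 17 `covLapM_add_eq_lapOp_sub`; dag-n15-c `…BackgroundDressedInverse` `unstackM_comp_bgPairM_eq`, M1 `bgPairM`∕`projO_none_bgPairM`∕
`hasMaj_unstackM`, B1a `isUnit_stepV`∕`hasMaj_bgPropV`, B2 `hasMaj_stack`∕`hasMaj_projO_comp`, FILE 47 `loc_ofBlocks_eq_zero`, lit `B6Prop26Gluing.ind`); nothing in the tree is modified.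

WHY.  Files 16–19 dressed dag-n15-c's DIRICHLET cube propagator `cubeInv (Δ − V) χ` — a two-sided cut-off sandwich, whence the cut-off's quotient `c_χ = η⁻¹` and the boundary letter.  But FILE 45's
gluing asks of a cube propagator only the per-cube locality `hloc : M_{h_□}∘Δ_a∘G_□ = M_{h_□}` (and dag-n15-a's PROGRAMME N supplies `G_□ := M_χ∘neumannCubeG` with `M_χ∘Δ∘G_□ = M_χ`, n15-c
l.28259 (a)).  For such a `G₀` the perturbative device needs NO compression: with the ORIGINAL species `V(c, a)` of (3.52)–(3.53), M1's pair `X̂ = (1 − Ĝ₀V̂)⁻¹Ĝ₀` satisfies `X = G₀ + G₀VX`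
((3.65)), hence `M_χ(Δ − V)X = M_χΔG₀(1 + VX) − M_χVX = M_χ` — `hloc` AT THE LIVE BACKGROUND, exactly; its entries `X, ∇^±X = pr_{±μ}X̂ ≤ β(1 − qc_r)⁻¹e^{−ρd}` come from B1a's Neumann series
with `q = β(r_c + r_a)(1 + |J ⊕ J|)` — (3.35)'s smallness, no `η⁻¹` anywhere — and are OUTPUT-localized over `S` as soon as `G₀`, `∇^±G₀` are (`X = G₀(1 + VX)`, `∇^±X = ∇^±G₀(1 + VX)`).

* §1 ★★ `mulOp_comp_sub_speciesOpM_comp_dressed` (`hloc` at the live background: `M_χ∘(Δ − V(c,a))∘pr₀X̂ = M_χ` from `M_χ∘Δ∘G₀ = M_χ`); `dressed_eq_comp_add` (`X = G₀∘(1 + VX)`),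
  `fgrad_dressed_eq_comp_add`∕`bgrad_dressed_eq_comp_add` (`∇^±X = ∇^±G₀∘(1 + VX)`);
* §2 `hasMaj_localize_out` (one-sided: outputs vanishing off `S` ⟹ `1_S(y)·K`); ★★ `hasMaj_bgPairM_orig` (unit ∧ pair majorant `β(1 − qc_r)⁻¹e^{−ρd}`, `q = β(r_c + r_a)(1 + |J ⊕ J|)`); ★★
  `hasMaj_dressed_of_hloc`, ★★ `hasMaj_fgrad_comp_dressed_of_hloc`, ★★ `hasMaj_bgrad_comp_dressed_of_hloc` (entries 0∕1, output-localized `1_S(y)·β(1 − qc_r)⁻¹e^{−ρd}` when `G₀`, `∇^±G₀` are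
  output-supported over `S`);
* §3 BY NAME at `Δ_U + W`: ★★★ `mulOp_comp_covLapM_add_comp_dressed` (`M_χ∘(Δ_U + W)∘X = M_χ` from `M_χ∘(lapOp η⁻¹ (liftEquiv∘τ) W)∘G₀ = M_χ`), ★★ `hasMaj_dressed_covLapM_add` (entry 0).

HONEST FRAMING ∕ LIMITS.  Finite-dimensional algebra + B1a's Neumann series over DISPLAYED letters: the flat cube propagator `G₀` with `hloc`, its entries `G₀, ∇^±G₀ ≤ βe^{−δd}` and output
supports (dag-n15-a's N-programme ∕ dag-n15-e's King objects are the tree's producers; not proved here), the transport rows `r_c, r_a` in the cube's (3.35) gauge; ONE grid (no η-defect); the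
INPUT localization and the RIGHT entries `X∘∇^±` (adjoint arrangement) are not here; nothing of [B6]∕[B9] asserted ((2.91) p. 239, (2.133) p. 247, (3.52)–(3.53) p. 400, (3.62)–(3.65) pp. 402–403,
p. 399 = SHAPES ∕ MECHANISM).  NE2⁺ NOT PRINTED, NOT proved; N15 NOT discharged; counts of record UNMOVED (typed 28∕28 · discharged 5∕27); one finite 𝕋⁴ at fixed ε — NOT infinite volume, NOT OS on
ℝ⁴, NOT a mass gap, NOT Clay; R4 closes the conditional finite-𝕋⁴ rung `BalabanLadder.UV` only.  Restate-immune (no Theses import).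
-/

set_option autoImplicit false

noncomputable section
open scoped BigOperators
open Finset

namespace Summit.QuantumFields.YangMills.BalabanUVNodes.N15.CurvedSpecies

open Literature.MathematicalPhysics.QuantumFieldTheory.Balaban1983to89
open Literature.MathematicalPhysics.QuantumFieldTheory.Balaban1983to89.B11SectG (BlockNorm HasMaj RowSum)
open Literature.MathematicalPhysics.QuantumFieldTheory.Balaban1983to89.T4EtaRateCoeffDefect (diagK diagK_nonneg)
open Literature.MathematicalPhysics.QuantumFieldTheory.Balaban1983to89.B6RandomWalk (Triangle254)
open Literature.MathematicalPhysics.QuantumFieldTheory.Balaban1983to89.B6Prop26Gluing (mulOp mulOp_apply ind ind_nonneg ind_of_mem)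
open Summit.QuantumFields.YangMills.BalabanUVNodes.N15.MatrixSpecies (mmulOp liftBlk liftEquiv liftEquiv_apply liftEquiv_symm_apply)
open Summit.QuantumFields.YangMills.BalabanUVNodes.N15.BackgroundLayer (fgrad bgrad speciesOpM stack projO blkPair hasMaj_stack hasMaj_projO_comp unstackM bgPairM projO_none_bgPairM
  projO_some_bgPairM hasMaj_unstackM isUnit_stepV hasMaj_bgPropV unstackM_comp_bgPairM_eq covLapM tCoefA tCoefC)
open Summit.QuantumFields.YangMills.BalabanUVNodes.N15.Gluing (lapOp loc_ofBlocks_eq_zero)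

variable {X ι J : Type} [Fintype X] [DecidableEq X] [Fintype ι] [DecidableEq ι] [Fintype J] [DecidableEq J] (τ : J → X ≃ X) (n : ℝ)
  {G₀ : (X × ι → ℝ) →ₗ[ℝ] (X × ι → ℝ)} {D : J ⊕ J → (X × ι → ℝ) →ₗ[ℝ] (X × ι → ℝ)} (C : X → Matrix ι ι ℝ) (A : J ⊕ J → X → Matrix ι ι ℝ)

/-! ## §1 `hloc` at the live background and the factorizations `X = G₀(1 + VX)`, `∇^±X = ∇^±G₀(1 + VX)` -/

section Hloc

/-- `X = G₀∘(1 + V∘X)` — (3.65) with the ORIGINAL species, the derived pieces being the quotients of `G₀`. [cite: Balaban1985BackgroundPropagators, (3.65) p.403] -/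
theorem dressed_eq_comp_add (hDf : ∀ μ, D (Sum.inl μ) = fgrad n (liftEquiv (τ μ) ι) ∘ₗ G₀) (hDb : ∀ μ, D (Sum.inr μ) = bgrad n (liftEquiv (τ μ) ι) ∘ₗ G₀)
    (hunit : IsUnit (1 - LinearMap.toMatrix' (stack G₀ D ∘ₗ unstackM C A))) :
    projO none ∘ₗ bgPairM G₀ D C A = G₀ ∘ₗ (LinearMap.id + speciesOpM τ n C A ∘ₗ (projO none ∘ₗ bgPairM G₀ D C A)) := by
  conv_lhs => rw [projO_none_bgPairM hunit, unstackM_comp_bgPairM_eq τ n G₀ C A hDf hDb hunit]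
  rw [LinearMap.comp_add, LinearMap.comp_id]

/-- `∇⁺_μX = ∇⁺_μG₀∘(1 + V∘X)`. [cite: Balaban1985BackgroundPropagators, (3.65) p.403; King1986, Prop. 3.9 (3.73) p.665 (derivative kernel: shape)] -/
theorem fgrad_dressed_eq_comp_add (hDf : ∀ μ, D (Sum.inl μ) = fgrad n (liftEquiv (τ μ) ι) ∘ₗ G₀) (hDb : ∀ μ, D (Sum.inr μ) = bgrad n (liftEquiv (τ μ) ι) ∘ₗ G₀)
    (hunit : IsUnit (1 - LinearMap.toMatrix' (stack G₀ D ∘ₗ unstackM C A))) (μ : J) :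
    fgrad n (liftEquiv (τ μ) ι) ∘ₗ (projO none ∘ₗ bgPairM G₀ D C A) = (fgrad n (liftEquiv (τ μ) ι) ∘ₗ G₀) ∘ₗ (LinearMap.id + speciesOpM τ n C A ∘ₗ (projO none ∘ₗ bgPairM G₀ D C A)) := by
  conv_lhs => rw [dressed_eq_comp_add τ n C A hDf hDb hunit]
  rw [LinearMap.comp_assoc]

/-- `∇⁻_μX = ∇⁻_μG₀∘(1 + V∘X)`. [cite: Balaban1985BackgroundPropagators, (3.65) p.403 (shape)] -/
theorem bgrad_dressed_eq_comp_add (hDf : ∀ μ, D (Sum.inl μ) = fgrad n (liftEquiv (τ μ) ι) ∘ₗ G₀) (hDb : ∀ μ, D (Sum.inr μ) = bgrad n (liftEquiv (τ μ) ι) ∘ₗ G₀)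
    (hunit : IsUnit (1 - LinearMap.toMatrix' (stack G₀ D ∘ₗ unstackM C A))) (μ : J) :
    bgrad n (liftEquiv (τ μ) ι) ∘ₗ (projO none ∘ₗ bgPairM G₀ D C A) = (bgrad n (liftEquiv (τ μ) ι) ∘ₗ G₀) ∘ₗ (LinearMap.id + speciesOpM τ n C A ∘ₗ (projO none ∘ₗ bgPairM G₀ D C A)) := by
  conv_lhs => rw [dressed_eq_comp_add τ n C A hDf hDb hunit]
  rw [LinearMap.comp_assoc]

/-- ★★ **`hloc` AT THE LIVE BACKGROUND**: if the flat cube propagator inverts `Δ` on the cube, `M_χ∘Δ∘G₀ = M_χ` (dag-n15-c FILE 45's `hloc`; e.g. `G₀ = M_χ∘neumannCubeG`), then the dressed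
propagator around it with the ORIGINAL species inverts `Δ − V(c, a)` on the cube: `M_χ∘(Δ − V(c,a))∘pr₀X̂ = M_χ` — no compression, no cut-off quotient. [cite: Balaban1984PropagatorsII, (2.91) p.239 (mechanism); Balaban1985BackgroundPropagators, (3.62)–(3.65) pp.402–403] -/
theorem mulOp_comp_sub_speciesOpM_comp_dressed (Δ : (X × ι → ℝ) →ₗ[ℝ] (X × ι → ℝ)) (χ : X × ι → ℝ) (hloc : mulOp χ ∘ₗ Δ ∘ₗ G₀ = mulOp χ)
    (hDf : ∀ μ, D (Sum.inl μ) = fgrad n (liftEquiv (τ μ) ι) ∘ₗ G₀) (hDb : ∀ μ, D (Sum.inr μ) = bgrad n (liftEquiv (τ μ) ι) ∘ₗ G₀)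
    (hunit : IsUnit (1 - LinearMap.toMatrix' (stack G₀ D ∘ₗ unstackM C A))) :
    mulOp χ ∘ₗ (Δ - speciesOpM τ n C A) ∘ₗ (projO none ∘ₗ bgPairM G₀ D C A) = mulOp χ := by
  have hX := dressed_eq_comp_add τ n C A hDf hDb hunit
  have hassoc : mulOp χ ∘ₗ Δ ∘ₗ (G₀ ∘ₗ (LinearMap.id + speciesOpM τ n C A ∘ₗ (projO none ∘ₗ bgPairM G₀ D C A))) =
      (mulOp χ ∘ₗ Δ ∘ₗ G₀) ∘ₗ (LinearMap.id + speciesOpM τ n C A ∘ₗ (projO none ∘ₗ bgPairM G₀ D C A)) := by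
    simp only [LinearMap.comp_assoc]
  have h1 : mulOp χ ∘ₗ Δ ∘ₗ (projO none ∘ₗ bgPairM G₀ D C A) = mulOp χ ∘ₗ (LinearMap.id + speciesOpM τ n C A ∘ₗ (projO none ∘ₗ bgPairM G₀ D C A)) := by
    conv_lhs => rw [hX]
    rw [hassoc, hloc]
  rw [LinearMap.sub_comp, LinearMap.comp_sub, h1, LinearMap.comp_add, LinearMap.comp_id]
  abel

end Hloc

/-! ## §2 The dressed cube's entries under the print-compatible smallness, output-localized -/

section Rows

variable {g : B6.Geometry} (blk : X → g.Site) {σ cr : ℝ}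

omit [DecidableEq X] [DecidableEq ι] [Fintype J] [DecidableEq J] in
/-- ONE-SIDED LOCALIZATION: an operator whose outputs vanish off `S` has its majorant `K ≥ 0` improved to `1_S(y)·K(y,y′)`. [cite: Balaban1984PropagatorsII, (2.133) p.247 («for y ∈ 𝔅 ∩ T_□»: shape)] -/
theorem hasMaj_localize_out {F : Type} [AddCommGroup F] [Module ℝ F] {b₁ : BlockNorm g F} {R : F →ₗ[ℝ] (X × ι → ℝ)} {S : Set g.Site} {K : g.Site → g.Site → ℝ}
    (hK : ∀ a b, 0 ≤ K a b) (hout : ∀ μ p, blk p.1 ∉ S → R μ p = 0) (hR : HasMaj b₁ (BlockNorm.ofBlocks g (liftBlk blk ι)) R K) :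
    HasMaj b₁ (BlockNorm.ofBlocks g (liftBlk blk ι)) R (fun y y' => ind S y * K y y') := by
  intro y' μ hμ y
  dsimp only
  by_cases hy : y ∈ S
  · rw [ind_of_mem hy, one_mul]
    exact hR y' μ hμ y
  · rw [loc_ofBlocks_eq_zero (liftBlk blk ι) fun p hp => hout μ p (by have hb : blk p.1 = y := hp; rw [hb]; exact hy)]
    exact mul_nonneg (mul_nonneg (ind_nonneg _ _) (hK _ _)) (b₁.loc_nonneg y' μ)

/-- ★★ THE PAIR AROUND A FLAT CUBE PROPAGATOR WITH THE ORIGINAL SPECIES: `G₀, ∇^±G₀ ≤ βe^{−δd}`, rows `r_c, r_a`, `q := β(r_c + r_a)(1 + |J ⊕ J|)`, `qc_r < 1`, `0 ≤ ρ`, `ρ + σ ≤ δ` ⟹ the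
Neumann unit holds and `X̂ ≤ β(1 − qc_r)⁻¹e^{−ρd}` (B1a `isUnit_stepV`∕`hasMaj_bgPropV`, B2 `hasMaj_stack`, M1 `hasMaj_unstackM`) — (3.35)'s smallness, no `η⁻¹`.
[cite: Balaban1985BackgroundPropagators, (3.63)–(3.64) pp.402–403 (mechanism); Balaban1984PropagatorsII, (2.52)–(2.56), (2.61)] -/
theorem hasMaj_bgPairM_orig (htri : Triangle254 g) (hd : ∀ a b : g.Site, 0 ≤ g.dist a b) (hrow : RowSum g σ cr) (hσ : 0 ≤ σ) {ρ δ β rC rA : ℝ} (hρ : 0 ≤ ρ) (hρδ : ρ + σ ≤ δ)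
    (hβ : 0 ≤ β) (hrC : 0 ≤ rC) (hrA : 0 ≤ rA) (hC : ∀ x i, ∑ k, |C x i k| ≤ rC) (hA : ∀ j x i, ∑ k, |A j x i k| ≤ rA)
    (hG : HasMaj (BlockNorm.ofBlocks g (liftBlk blk ι)) (BlockNorm.ofBlocks g (liftBlk blk ι)) G₀ (fun y y' => β * Real.exp (-(δ * g.dist y y'))))
    (hD : ∀ j, HasMaj (BlockNorm.ofBlocks g (liftBlk blk ι)) (BlockNorm.ofBlocks g (liftBlk blk ι)) (D j) (fun y y' => β * Real.exp (-(δ * g.dist y y'))))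
    (hq : β * ((rC + rA) * (1 + Fintype.card (J ⊕ J))) * cr < 1) :
    IsUnit (1 - LinearMap.toMatrix' (stack G₀ D ∘ₗ unstackM C A)) ∧
      HasMaj (BlockNorm.ofBlocks g (liftBlk blk ι)) (BlockNorm.ofBlocks g (blkPair (liftBlk blk ι))) (bgPairM G₀ D C A)
        (fun y y' => β * (1 - β * ((rC + rA) * (1 + Fintype.card (J ⊕ J))) * cr)⁻¹ * Real.exp (-(ρ * g.dist y y'))) := by
  have hR0 : 0 ≤ rC + rA := by positivity
  have hCt : ∀ x i, ∑ k, |C x i k| ≤ rC + rA := fun x i => (hC x i).trans (by linarith)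
  have hAt : ∀ j x i, ∑ k, |A j x i k| ≤ rC + rA := fun j x i => (hA j x i).trans (by linarith)
  have hV := hasMaj_unstackM (g := g) blk (J := J ⊕ J) hR0 hCt hAt
  have hS := hasMaj_stack (liftBlk blk ι) (fun _ _ => mul_nonneg hβ (Real.exp_nonneg _)) hG hD
  have hσδ : σ ≤ δ := by linarith
  exact ⟨isUnit_stepV (liftBlk blk ι) (blkPair (liftBlk blk ι)) hd hrow hσδ hβ (mul_nonneg hR0 (by positivity)) hS hV hq,
    hasMaj_bgPropV (liftBlk blk ι) (blkPair (liftBlk blk ι)) htri hd hrow hσ hρ hρδ hβ (mul_nonneg hR0 (by positivity)) hS hV hq⟩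

/-- ★★ **ENTRY 0 OF THE DRESSED CUBE PROPAGATOR, OUTPUT-LOCALIZED**: under `hasMaj_bgPairM_orig`'s data and `G₀ = M_{χ}∘G₀` with `supp χ` over `S` (outputs in the cube),
`pr₀X̂ ≤ 1_S(y)·β(1 − qc_r)⁻¹·e^{−ρd}`. [cite: Balaban1984PropagatorsII, (2.133) p.247 (shape); Balaban1985BackgroundPropagators, (3.65) p.403 (mechanism)] -/
theorem hasMaj_dressed_of_hloc (htri : Triangle254 g) (hd : ∀ a b : g.Site, 0 ≤ g.dist a b) (hrow : RowSum g σ cr) (hσ : 0 ≤ σ) {ρ δ β rC rA : ℝ} (hρ : 0 ≤ ρ) (hρδ : ρ + σ ≤ δ)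
    (hβ : 0 ≤ β) (hrC : 0 ≤ rC) (hrA : 0 ≤ rA) {S : Set g.Site} {χX : X → ℝ} (hS : ∀ x, χX x ≠ 0 → blk x ∈ S) (hGχ : mulOp (fun p : X × ι => χX p.1) ∘ₗ G₀ = G₀)
    (hC : ∀ x i, ∑ k, |C x i k| ≤ rC) (hA : ∀ j x i, ∑ k, |A j x i k| ≤ rA) (hDf : ∀ μ, D (Sum.inl μ) = fgrad n (liftEquiv (τ μ) ι) ∘ₗ G₀)
    (hDb : ∀ μ, D (Sum.inr μ) = bgrad n (liftEquiv (τ μ) ι) ∘ₗ G₀)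
    (hG : HasMaj (BlockNorm.ofBlocks g (liftBlk blk ι)) (BlockNorm.ofBlocks g (liftBlk blk ι)) G₀ (fun y y' => β * Real.exp (-(δ * g.dist y y'))))
    (hD : ∀ j, HasMaj (BlockNorm.ofBlocks g (liftBlk blk ι)) (BlockNorm.ofBlocks g (liftBlk blk ι)) (D j) (fun y y' => β * Real.exp (-(δ * g.dist y y'))))
    (hq : β * ((rC + rA) * (1 + Fintype.card (J ⊕ J))) * cr < 1) :
    HasMaj (BlockNorm.ofBlocks g (liftBlk blk ι)) (BlockNorm.ofBlocks g (liftBlk blk ι)) (projO none ∘ₗ bgPairM G₀ D C A)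
      (fun y y' => ind S y * (β * (1 - β * ((rC + rA) * (1 + Fintype.card (J ⊕ J))) * cr)⁻¹ * Real.exp (-(ρ * g.dist y y')))) := by
  obtain ⟨hunit, hX⟩ := hasMaj_bgPairM_orig C A blk htri hd hrow hσ hρ hρδ hβ hrC hrA hC hA hG hD hq
  have hβX : 0 ≤ β * (1 - β * ((rC + rA) * (1 + Fintype.card (J ⊕ J))) * cr)⁻¹ := mul_nonneg hβ (inv_nonneg.2 (by linarith))
  have hfac := dressed_eq_comp_add τ n C A hDf hDb hunit
  refine hasMaj_localize_out blk (fun a b => mul_nonneg hβX (Real.exp_nonneg _)) (fun μ p hp => ?_) (hasMaj_projO_comp (liftBlk blk ι) hX none)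
  have hχ0 : χX p.1 = 0 := by by_contra h; exact hp (hS p.1 h)
  rw [hfac, ← hGχ]
  simp only [LinearMap.comp_apply, mulOp_apply, hχ0, zero_mul]

/-- ★★ **ENTRY 1 (forward), OUTPUT-LOCALIZED**: `∇⁺_μ∘pr₀X̂ ≤ 1_S(y)·β(1 − qc_r)⁻¹·e^{−ρd}` when `∇⁺_μG₀ = M_{ψ}∘∇⁺_μG₀` with `supp ψ` over `S` (e.g. `ψ` = the cube's one-step neighbourhood).
[cite: Balaban1984PropagatorsII, (2.133) p.247 («|(∇G_□J)(x)|»: shape); Balaban1985BackgroundPropagators, (3.65) p.403 (mechanism)] -/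
theorem hasMaj_fgrad_comp_dressed_of_hloc (htri : Triangle254 g) (hd : ∀ a b : g.Site, 0 ≤ g.dist a b) (hrow : RowSum g σ cr) (hσ : 0 ≤ σ) {ρ δ β rC rA : ℝ} (hρ : 0 ≤ ρ)
    (hρδ : ρ + σ ≤ δ) (hβ : 0 ≤ β) (hrC : 0 ≤ rC) (hrA : 0 ≤ rA) {S : Set g.Site} (μ : J) {ψX : X → ℝ} (hS : ∀ x, ψX x ≠ 0 → blk x ∈ S)
    (hDψ : mulOp (fun p : X × ι => ψX p.1) ∘ₗ (fgrad n (liftEquiv (τ μ) ι) ∘ₗ G₀) = fgrad n (liftEquiv (τ μ) ι) ∘ₗ G₀)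
    (hC : ∀ x i, ∑ k, |C x i k| ≤ rC) (hA : ∀ j x i, ∑ k, |A j x i k| ≤ rA) (hDf : ∀ μ, D (Sum.inl μ) = fgrad n (liftEquiv (τ μ) ι) ∘ₗ G₀)
    (hDb : ∀ μ, D (Sum.inr μ) = bgrad n (liftEquiv (τ μ) ι) ∘ₗ G₀)
    (hG : HasMaj (BlockNorm.ofBlocks g (liftBlk blk ι)) (BlockNorm.ofBlocks g (liftBlk blk ι)) G₀ (fun y y' => β * Real.exp (-(δ * g.dist y y'))))
    (hD : ∀ j, HasMaj (BlockNorm.ofBlocks g (liftBlk blk ι)) (BlockNorm.ofBlocks g (liftBlk blk ι)) (D j) (fun y y' => β * Real.exp (-(δ * g.dist y y'))))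
    (hq : β * ((rC + rA) * (1 + Fintype.card (J ⊕ J))) * cr < 1) :
    HasMaj (BlockNorm.ofBlocks g (liftBlk blk ι)) (BlockNorm.ofBlocks g (liftBlk blk ι)) (fgrad n (liftEquiv (τ μ) ι) ∘ₗ (projO none ∘ₗ bgPairM G₀ D C A))
      (fun y y' => ind S y * (β * (1 - β * ((rC + rA) * (1 + Fintype.card (J ⊕ J))) * cr)⁻¹ * Real.exp (-(ρ * g.dist y y')))) := by
  obtain ⟨hunit, hX⟩ := hasMaj_bgPairM_orig C A blk htri hd hrow hσ hρ hρδ hβ hrC hrA hC hA hG hD hq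
  have hβX : 0 ≤ β * (1 - β * ((rC + rA) * (1 + Fintype.card (J ⊕ J))) * cr)⁻¹ := mul_nonneg hβ (inv_nonneg.2 (by linarith))
  have hfac := fgrad_dressed_eq_comp_add τ n C A hDf hDb hunit μ
  have hcomp : HasMaj (BlockNorm.ofBlocks g (liftBlk blk ι)) (BlockNorm.ofBlocks g (liftBlk blk ι)) (fgrad n (liftEquiv (τ μ) ι) ∘ₗ (projO none ∘ₗ bgPairM G₀ D C A))
      (fun y y' => β * (1 - β * ((rC + rA) * (1 + Fintype.card (J ⊕ J))) * cr)⁻¹ * Real.exp (-(ρ * g.dist y y'))) := by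
    rw [fgrad_comp_dressed τ n C A hDf hunit μ]
    exact hasMaj_projO_comp (liftBlk blk ι) hX (some (Sum.inl μ))
  refine hasMaj_localize_out blk (fun a b => mul_nonneg hβX (Real.exp_nonneg _)) (fun v p hp => ?_) hcomp
  have hψ0 : ψX p.1 = 0 := by by_contra h; exact hp (hS p.1 h)
  rw [hfac, ← hDψ]
  simp only [LinearMap.comp_apply, mulOp_apply, hψ0, zero_mul]

/-- ★★ **ENTRY 1 (backward), OUTPUT-LOCALIZED**: `∇⁻_μ∘pr₀X̂ ≤ 1_S(y)·β(1 − qc_r)⁻¹·e^{−ρd}` when `∇⁻_μG₀ = M_ψ∘∇⁻_μG₀`, `supp ψ` over `S`. [cite: Balaban1984PropagatorsII, (2.133) p.247 (shape)] -/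
theorem hasMaj_bgrad_comp_dressed_of_hloc (htri : Triangle254 g) (hd : ∀ a b : g.Site, 0 ≤ g.dist a b) (hrow : RowSum g σ cr) (hσ : 0 ≤ σ) {ρ δ β rC rA : ℝ} (hρ : 0 ≤ ρ)
    (hρδ : ρ + σ ≤ δ) (hβ : 0 ≤ β) (hrC : 0 ≤ rC) (hrA : 0 ≤ rA) {S : Set g.Site} (μ : J) {ψX : X → ℝ} (hS : ∀ x, ψX x ≠ 0 → blk x ∈ S)
    (hDψ : mulOp (fun p : X × ι => ψX p.1) ∘ₗ (bgrad n (liftEquiv (τ μ) ι) ∘ₗ G₀) = bgrad n (liftEquiv (τ μ) ι) ∘ₗ G₀)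
    (hC : ∀ x i, ∑ k, |C x i k| ≤ rC) (hA : ∀ j x i, ∑ k, |A j x i k| ≤ rA) (hDf : ∀ μ, D (Sum.inl μ) = fgrad n (liftEquiv (τ μ) ι) ∘ₗ G₀)
    (hDb : ∀ μ, D (Sum.inr μ) = bgrad n (liftEquiv (τ μ) ι) ∘ₗ G₀)
    (hG : HasMaj (BlockNorm.ofBlocks g (liftBlk blk ι)) (BlockNorm.ofBlocks g (liftBlk blk ι)) G₀ (fun y y' => β * Real.exp (-(δ * g.dist y y'))))
    (hD : ∀ j, HasMaj (BlockNorm.ofBlocks g (liftBlk blk ι)) (BlockNorm.ofBlocks g (liftBlk blk ι)) (D j) (fun y y' => β * Real.exp (-(δ * g.dist y y'))))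
    (hq : β * ((rC + rA) * (1 + Fintype.card (J ⊕ J))) * cr < 1) :
    HasMaj (BlockNorm.ofBlocks g (liftBlk blk ι)) (BlockNorm.ofBlocks g (liftBlk blk ι)) (bgrad n (liftEquiv (τ μ) ι) ∘ₗ (projO none ∘ₗ bgPairM G₀ D C A))
      (fun y y' => ind S y * (β * (1 - β * ((rC + rA) * (1 + Fintype.card (J ⊕ J))) * cr)⁻¹ * Real.exp (-(ρ * g.dist y y')))) := by
  obtain ⟨hunit, hX⟩ := hasMaj_bgPairM_orig C A blk htri hd hrow hσ hρ hρδ hβ hrC hrA hC hA hG hD hq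
  have hβX : 0 ≤ β * (1 - β * ((rC + rA) * (1 + Fintype.card (J ⊕ J))) * cr)⁻¹ := mul_nonneg hβ (inv_nonneg.2 (by linarith))
  have hfac := bgrad_dressed_eq_comp_add τ n C A hDf hDb hunit μ
  have hcomp : HasMaj (BlockNorm.ofBlocks g (liftBlk blk ι)) (BlockNorm.ofBlocks g (liftBlk blk ι)) (bgrad n (liftEquiv (τ μ) ι) ∘ₗ (projO none ∘ₗ bgPairM G₀ D C A))
      (fun y y' => β * (1 - β * ((rC + rA) * (1 + Fintype.card (J ⊕ J))) * cr)⁻¹ * Real.exp (-(ρ * g.dist y y'))) := by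
    rw [bgrad_comp_dressed τ n C A hDb hunit μ]
    exact hasMaj_projO_comp (liftBlk blk ι) hX (some (Sum.inr μ))
  refine hasMaj_localize_out blk (fun a b => mul_nonneg hβX (Real.exp_nonneg _)) (fun v p hp => ?_) hcomp
  have hψ0 : ψX p.1 = 0 := by by_contra h; exact hp (hS p.1 h)
  rw [hfac, ← hDψ]
  simp only [LinearMap.comp_apply, mulOp_apply, hψ0, zero_mul]

end Rows

/-! ## §3 By name at `Δ_U + W` -/

section Covariant

variable (η : ℝ) (U : J ⊕ J → X → Matrix ι ι ℝ) (W : (X × ι → ℝ) →ₗ[ℝ] (X × ι → ℝ))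

/-- ★★★ **`hloc` FOR THE DRESSED CUBE PROPAGATOR OF `Δ_U + W`** (dag-n15-c FILE 45's `hloc` at a LIVE background): if the flat cube propagator `G₀` inverts the flat part on the cube,
`M_χ∘(lapOp η⁻¹ (liftEquiv∘τ) W)∘G₀ = M_χ`, then the pair around it with the transport species `V(c_U, a_U)` (`a_U = tCoefA η U`, `c_U = tCoefC η U`) inverts Bałaban's operator on the cube:
`M_χ∘(Δ_U + W)∘pr₀X̂ = M_χ`. [cite: Balaban1984PropagatorsII, (2.91) p.239 (mechanism); Balaban1985BackgroundPropagators, (3.50)–(3.53) p.400, (3.62)–(3.65) pp.402–403] -/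
theorem mulOp_comp_covLapM_add_comp_dressed (χ : X × ι → ℝ) {D' : J ⊕ J → (X × ι → ℝ) →ₗ[ℝ] (X × ι → ℝ)}
    (hloc : mulOp χ ∘ₗ lapOp η⁻¹ (fun μ => liftEquiv (τ μ) ι) W ∘ₗ G₀ = mulOp χ) (hDf : ∀ μ, D' (Sum.inl μ) = fgrad η⁻¹ (liftEquiv (τ μ) ι) ∘ₗ G₀)
    (hDb : ∀ μ, D' (Sum.inr μ) = bgrad η⁻¹ (liftEquiv (τ μ) ι) ∘ₗ G₀) (hunit : IsUnit (1 - LinearMap.toMatrix' (stack G₀ D' ∘ₗ unstackM (tCoefC η U) (tCoefA η U)))) :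
    mulOp χ ∘ₗ (covLapM τ η U + W) ∘ₗ (projO none ∘ₗ bgPairM G₀ D' (tCoefC η U) (tCoefA η U)) = mulOp χ := by
  rw [covLapM_add_eq_lapOp_sub]
  exact mulOp_comp_sub_speciesOpM_comp_dressed τ η⁻¹ (tCoefC η U) (tCoefA η U) _ χ hloc hDf hDb hunit

variable {g : B6.Geometry} (blk : X → g.Site) {σ cr : ℝ}

/-- ★★ **ENTRY 0 OF THE DRESSED CUBE PROPAGATOR OF `Δ_U + W`, OUTPUT-LOCALIZED, PRINT-COMPATIBLE SMALLNESS**: from the flat cube propagator's entries `G₀, ∇^±G₀ ≤ βe^{−δd}`, its output cut-off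
`G₀ = M_χG₀` (`supp χ` over `S`), and the transport rows `Σ_k|c_U(x)_{ik}| ≤ r_c`, `Σ_k|a_U{}^±(x)_{ik}| ≤ r_a`: with `q = β(r_c + r_a)(1 + |J ⊕ J|)`, `qc_r < 1`,
`pr₀X̂ ≤ 1_S(y)·β(1 − qc_r)⁻¹·e^{−ρd}` — FILE 45∕55's `hG` row for the dressed cube at the live background `U` (entries 1: §2 verbatim at `n = η⁻¹`).
[cite: Balaban1985BackgroundPropagators, p.399 («expanding with respect to A»), (3.50)–(3.53) p.400; Balaban1984PropagatorsII, (2.133) p.247 (shape)] -/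
theorem hasMaj_dressed_covLapM_add (htri : Triangle254 g) (hd : ∀ a b : g.Site, 0 ≤ g.dist a b) (hrow : RowSum g σ cr) (hσ : 0 ≤ σ) {ρ δ β rC rA : ℝ} (hρ : 0 ≤ ρ) (hρδ : ρ + σ ≤ δ)
    (hβ : 0 ≤ β) (hrC : 0 ≤ rC) (hrA : 0 ≤ rA) {S : Set g.Site} {χX : X → ℝ} {D' : J ⊕ J → (X × ι → ℝ) →ₗ[ℝ] (X × ι → ℝ)} (hS : ∀ x, χX x ≠ 0 → blk x ∈ S)
    (hGχ : mulOp (fun p : X × ι => χX p.1) ∘ₗ G₀ = G₀) (hC : ∀ x i, ∑ k, |tCoefC η U x i k| ≤ rC) (hA : ∀ j x i, ∑ k, |tCoefA η U j x i k| ≤ rA)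
    (hDf : ∀ μ, D' (Sum.inl μ) = fgrad η⁻¹ (liftEquiv (τ μ) ι) ∘ₗ G₀) (hDb : ∀ μ, D' (Sum.inr μ) = bgrad η⁻¹ (liftEquiv (τ μ) ι) ∘ₗ G₀)
    (hG : HasMaj (BlockNorm.ofBlocks g (liftBlk blk ι)) (BlockNorm.ofBlocks g (liftBlk blk ι)) G₀ (fun y y' => β * Real.exp (-(δ * g.dist y y'))))
    (hD : ∀ j, HasMaj (BlockNorm.ofBlocks g (liftBlk blk ι)) (BlockNorm.ofBlocks g (liftBlk blk ι)) (D' j) (fun y y' => β * Real.exp (-(δ * g.dist y y'))))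
    (hq : β * ((rC + rA) * (1 + Fintype.card (J ⊕ J))) * cr < 1) :
    HasMaj (BlockNorm.ofBlocks g (liftBlk blk ι)) (BlockNorm.ofBlocks g (liftBlk blk ι)) (projO none ∘ₗ bgPairM G₀ D' (tCoefC η U) (tCoefA η U))
      (fun y y' => ind S y * (β * (1 - β * ((rC + rA) * (1 + Fintype.card (J ⊕ J))) * cr)⁻¹ * Real.exp (-(ρ * g.dist y y')))) :=
  hasMaj_dressed_of_hloc τ η⁻¹ (tCoefC η U) (tCoefA η U) blk htri hd hrow hσ hρ hρδ hβ hrC hrA hS hGχ hC hA hDf hDb hG hD hq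

end Covariant

end Summit.QuantumFields.YangMills.BalabanUVNodes.N15.CurvedSpecies

end
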